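import Literature.Geometry.Lorentzian.KillingInitialDataPairing
import Literature.Geometry.Lorentzian.InitialData
import Literature.Geometry.Lorentzian.Basic
import Mathlib.Analysis.InnerProductSpace.Calculus
import HarnessLib

/-!
# Sen–Witten-parallel spinor fields give translational Killing initial data

The ANALYTIC half of the rigid positive energy theorem (Beig–Chruściel, J. Math. Phys. 37
(1996), Thm. 4.1, `m = 0`; the binder `hA` of
`positive_mass_rigidity_spacetime_of_kids_of_simplyConnected`,
`SpacetimePositiveMassRigidityReduction.lean`) produces the translational Killing initial data
`(N_a, Y_a)` from spinor fields: by Witten's argument with `m = 0` the Sen–Witten connection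
`𝒟ᵥψ = Dᵥψ + ½ k(v, eᵢ) γⁱγ⁰ ψ` has a full space of parallel spinors, and App. A,
(A.10)–(A.11.0) shows that for parallel `ψ` the pair `N = ψ†ψ`, `Yᵢ = ψ†γ₀γᵢψ` satisfies the
KID system `DᵢYⱼ = −N kᵢⱼ`, `DᵢN = −kᵢⱼYʲ`. This file proves that algebraic–differential step
in a bundle-free form usable without a formalised spin geometry: spinor fields are maps
`ψ : X → S` into a real inner product space `S` carrying symmetric operators `σ₁, σ₂, σ₃` with
the Clifford relations `σᵢσⱼ + σⱼσᵢ = 2δᵢⱼ` (for `S = ℂ² ≅ ℝ⁴` the Pauli matrices), read in a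
global `h`-orthonormal frame `(F₁, F₂, F₃)` of `X` with connection coefficients
`ω_{ij}(v) = h(∇ᵥFᵢ, Fⱼ)`; the Sen–Witten-parallel equation is
`dψ(v) = ¼ Σ ω_{ij}(v) σᵢσⱼψ − ½ Σ k(v, Fᵢ) σᵢψ`.

* `SenParallel.pairing_identities` — the Clifford algebra: with `P = ¼ Σ ω_{ij}σᵢσⱼ − ½ Σ κᵢσᵢ`
  (`ω` antisymmetric), `⟪Pψ, φ⟫ + ⟪ψ, Pφ⟫ = −Σ κᵢ⟪ψ, σᵢφ⟫` and
  `⟪Pψ, σⱼφ⟫ + ⟪ψ, σⱼPφ⟫ = −Σᵢ ω_{ij}⟪ψ, σᵢφ⟫ − κⱼ⟪ψ, φ⟫`;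
* `SenParallel.mvfderiv_real_inner`, `mvfderiv_clm_apply_comp` (and `HasMFDerivAt` /
  smoothness forms) — Leibniz rules for pairings of vector-valued maps on a manifold;
* `SenParallel.val_leviCivita_frame_antisymm`, `val_leviCivita_frameSum`, `clm_eq_of_frame` —
  orthonormal-frame calculus on the data manifold (`ω_{ij} = −ω_{ji}`,
  `h(∇ᵥ Σ cᵢFᵢ, Fⱼ) = dcⱼ(v) + Σ cᵢ ω_{ij}(v)`, a triad is a basis);
* `SenParallel.kid_of_parallel` — **main result**: for Sen–Witten-parallel `ψ, φ` the pairing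
  `N = ⟪ψ, φ⟫`, `Y = Σ ⟪ψ, σᵢφ⟫ Fᵢ` satisfies the lapse equation `dN(v) = −k(v, Y)` and the
  shift equation `h(∇ᵥY, w) = −N k(v, w)`;
* `SenParallel.contMDiff_pairingLapse`, `contMDiff_pairingShift`, `parallel_clm_comp` —
  smoothness of `(N, Y)`, and stability of parallel spinors under operators commuting with the
  `σᵢ` (the complex structure of `ℂ²` doubles a parallel spinor).

With two parallel spinors `ψ₁, ψ₂ = Jψ₁, …` the four pairings give the four translational KIDs;
their Gram matrix `−N_aN_b + h(Y_a, Y_b)` is locally constant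
(`InitialDataSet.kidPairing_eq_of_isPreconnected`, `TranslationalKIDImmersion.lean`), so it
is `η` as soon as it is `η` at one point. Theorems only; no definitions, no named facts.

## References

* R. Beig, P. T. Chruściel, *Killing vectors in asymptotically flat space-times. I.
  Asymptotically translational Killing vectors and the rigid positive energy theorem*, J. Math.
  Phys. 37 (1996) 1939–1961, arXiv:gr-qc/9510015: App. A, (A.7)–(A.11.0); Thm. 4.1.
  [BeigChrusciel1996]
* E. Witten, *A new proof of the positive energy theorem*, Comm. Math. Phys. 80 (1981)
  381–402, §3. [Witten1981]
* B. O'Neill, *Semi-Riemannian geometry*, Academic Press 1983, Ch. 3, Thm. 3.11 and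
  Prop. 3.13. [ONeill1983]
-/

noncomputable section

open Bundle Set Function Manifold Finset
open scoped Manifold ContDiff Topology RealInnerProductSpace

namespace Literature.Geometry.Lorentzian

namespace SenParallel

/-! ### Clifford algebra: the two pairing identities -/

section Algebra

variable {S : Type*} [NormedAddCommGroup S] [InnerProductSpace ℝ S]

/-- **The pairing identities.** Let `σ₁, σ₂, σ₃` be symmetric operators on a real inner product
space `S` with the Clifford relations `σᵢσⱼ + σⱼσᵢ = 2δᵢⱼ`, `ω_{ij} = −ω_{ji}` and `κᵢ` real
numbers, and `P = ¼ Σ ω_{ij} σᵢσⱼ − ½ Σ κᵢ σᵢ` (the value of the Sen–Witten connection form on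
a tangent vector, in an orthonormal frame). Then for all `ψ, φ ∈ S`:
`⟪Pψ, φ⟫ + ⟪ψ, Pφ⟫ = −Σ κᵢ ⟪ψ, σᵢφ⟫` and
`⟪Pψ, σⱼφ⟫ + ⟪ψ, σⱼPφ⟫ = −Σᵢ ω_{ij} ⟪ψ, σᵢφ⟫ − κⱼ ⟪ψ, φ⟫`
(only symmetry of the `σᵢ`, the Clifford relations and the antisymmetry of `Ω` are used:
`[σⱼ, σᵢσₖ] = 2δᵢⱼσₖ − 2δⱼₖσᵢ`). This is the algebra of Beig–Chruściel 1996, App. A,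
(A.10)–(A.11.0) (a Sen-parallel spinor `ψ` gives the KID `N = ψ†ψ`, `Yᵢ = ψ†γ₀γᵢψ`).
[cite: BeigChrusciel1996, App. A, (A.10)–(A.11.0)] -/
theorem pairing_identities (σ : Fin 3 → S →L[ℝ] S) (hsymm : ∀ i a b, ⟪σ i a, b⟫ = ⟪a, σ i b⟫)
    (hcl : ∀ i j a, σ i (σ j a) + σ j (σ i a) = if i = j then (2 : ℝ) • a else 0)
    (Ω : Fin 3 → Fin 3 → ℝ) (hω : ∀ i j, Ω i j = -Ω j i) (κ : Fin 3 → ℝ) (ψ φ : S)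
    (P : S → S) (hP : ∀ a, P a =
      (1 / 4 : ℝ) • (∑ i, ∑ j, Ω i j • σ i (σ j a)) - (1 / 2 : ℝ) • ∑ i, κ i • σ i a) :
    (⟪P ψ, φ⟫ + ⟪ψ, P φ⟫ = -∑ i, κ i * ⟪ψ, σ i φ⟫) ∧
      ∀ j, ⟪P ψ, σ j φ⟫ + ⟪ψ, σ j (P φ)⟫ =
        -(∑ i, Ω i j * ⟪ψ, σ i φ⟫) - κ j * ⟪ψ, φ⟫ := by
  -- Clifford normalisation rules
  have hsq : ∀ i (a : S), σ i (σ i a) = a := fun i a ↦ by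
    have h := hcl i i a
    rw [if_pos rfl, ← two_smul ℝ] at h
    exact smul_right_injective S (two_ne_zero) h
  have hanti : ∀ i j (a : S), i ≠ j → σ j (σ i a) = -σ i (σ j a) := fun i j a hij ↦ by
    have h := hcl i j a
    rw [if_neg hij] at h
    exact eq_neg_of_add_eq_zero_right h
  have h10 : ∀ a : S, σ 1 (σ 0 a) = -σ 0 (σ 1 a) := fun a ↦ hanti 0 1 a (by decide)
  have h20 : ∀ a : S, σ 2 (σ 0 a) = -σ 0 (σ 2 a) := fun a ↦ hanti 0 2 a (by decide)
  have h21 : ∀ a : S, σ 2 (σ 1 a) = -σ 1 (σ 2 a) := fun a ↦ hanti 1 2 a (by decide)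
  have hωd : ∀ i, Ω i i = 0 := fun i ↦ by linarith [hω i i]
  have hω10 := hω 1 0
  have hω20 := hω 2 0
  have hω21 := hω 2 1
  have hω00 := hωd 0
  have hω11 := hωd 1
  have hω22 := hωd 2
  have part2 : ∀ j, ⟪P ψ, σ j φ⟫ + ⟪ψ, σ j (P φ)⟫ =
      -(∑ i, Ω i j * ⟪ψ, σ i φ⟫) - κ j * ⟪ψ, φ⟫ := by
    intro j
    rw [hP ψ, hP φ]
    match j with
    | 0 =>
      simp only [Fin.sum_univ_three, inner_sub_left, inner_add_left, inner_smul_left,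
        inner_sub_right, inner_add_right, inner_smul_right, RCLike.conj_to_real, map_sub,
        map_add, map_smul, inner_neg_left, inner_neg_right, map_neg, hsymm, hsq, h10, h20, h21,
        hω10, hω20, hω21, hω00, hω11, hω22]
      ring
    | 1 =>
      simp only [Fin.sum_univ_three, inner_sub_left, inner_add_left, inner_smul_left,
        inner_sub_right, inner_add_right, inner_smul_right, RCLike.conj_to_real, map_sub,
        map_add, map_smul, inner_neg_left, inner_neg_right, map_neg, hsymm, hsq, h10, h20, h21,
        hω10, hω20, hω21, hω00, hω11, hω22]
      ring
    | 2 =>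
      simp only [Fin.sum_univ_three, inner_sub_left, inner_add_left, inner_smul_left,
        inner_sub_right, inner_add_right, inner_smul_right, RCLike.conj_to_real, map_sub,
        map_add, map_smul, inner_neg_left, inner_neg_right, map_neg, hsymm, hsq, h10, h20, h21,
        hω10, hω20, hω21, hω00, hω11, hω22]
      ring
  refine ⟨?_, part2⟩
  rw [hP ψ, hP φ]
  simp only [Fin.sum_univ_three, inner_sub_left, inner_add_left, inner_smul_left,
    inner_sub_right, inner_add_right, inner_smul_right, RCLike.conj_to_real, inner_neg_left,
    inner_neg_right, map_neg, hsymm, hsq, h10, h20, h21, hω10, hω20, hω21, hω00, hω11, hω22]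
  ring

end Algebra

/-! ### Calculus: derivatives of pairings of vector-valued maps on a manifold -/

section Calculus

variable {E H M S S' : Type*} [NormedAddCommGroup E] [NormedSpace ℝ E] [TopologicalSpace H]
  {I : ModelWithCorners ℝ E H} [TopologicalSpace M] [ChartedSpace H M]
  [NormedAddCommGroup S] [InnerProductSpace ℝ S] [NormedAddCommGroup S'] [NormedSpace ℝ S']

/-- **Leibniz rule for a real inner product of manifold maps** (`HasMFDerivAt` form): the pairing
`y ↦ ⟪ψ y, φ y⟫` of two maps into an inner product space has derivative
`w ↦ ⟪ψ x, dφ w⟫ + ⟪dψ w, φ x⟫`. [folklore] -/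
theorem hasMFDerivAt_real_inner {ψ φ : M → S} {x : M}
    {dψ dφ : TangentSpace I x →L[ℝ] S}
    (hψ : HasMFDerivAt I 𝓘(ℝ, S) ψ x dψ) (hφ : HasMFDerivAt I 𝓘(ℝ, S) φ x dφ) :
    HasMFDerivAt I 𝓘(ℝ, ℝ) (fun y ↦ ⟪ψ y, φ y⟫) x
      ((fderivInnerCLM ℝ (ψ x, φ x)).comp (dψ.prod dφ)) := by
  have h1 : HasMFDerivAt I 𝓘(ℝ, S × S) (fun y ↦ (ψ y, φ y)) x (dψ.prod dφ) :=
    ⟨hψ.1.prodMk hφ.1, hψ.2.prodMk hφ.2⟩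
  have h2 : HasMFDerivAt 𝓘(ℝ, S × S) 𝓘(ℝ, ℝ) (fun p : S × S ↦ ⟪p.1, p.2⟫) (ψ x, φ x)
      (fderivInnerCLM ℝ (ψ x, φ x)) :=
    hasMFDerivAt_iff_hasFDerivAt.2
      ((isBoundedBilinearMap_inner (𝕜 := ℝ) (E := S)).hasFDerivAt (ψ x, φ x))
  exact h2.comp x h1

/-- **Leibniz rule for a real inner product of manifold maps**:
`d⟪ψ, φ⟫(v) = ⟪dψ(v), φ⟫ + ⟪ψ, dφ(v)⟫`. [folklore] -/
theorem mvfderiv_real_inner {ψ φ : M → S} {x : M} (hψ : MDiffAt ψ x) (hφ : MDiffAt φ x)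
    (v : TangentSpace I x) :
    mvfderiv I (fun y ↦ ⟪ψ y, φ y⟫) x v = ⟪mvfderiv I ψ x v, φ x⟫ + ⟪ψ x, mvfderiv I φ x v⟫ := by
  have h := hasMFDerivAt_real_inner hψ.hasMFDerivAt hφ.hasMFDerivAt
  show mfderiv I 𝓘(ℝ, ℝ) (fun y ↦ ⟪ψ y, φ y⟫) x v = _
  rw [h.mfderiv]
  show fderivInnerCLM ℝ (ψ x, φ x) (mfderiv I 𝓘(ℝ, S) ψ x v, mfderiv I 𝓘(ℝ, S) φ x v) = _
  rw [fderivInnerCLM_apply]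
  exact add_comm _ _

/-- The pairing of differentiable maps is differentiable. [folklore] -/
theorem mdifferentiableAt_real_inner {ψ φ : M → S} {x : M} (hψ : MDiffAt ψ x) (hφ : MDiffAt φ x) :
    MDiffAt (fun y ↦ ⟪ψ y, φ y⟫) x :=
  (hasMFDerivAt_real_inner hψ.hasMFDerivAt hφ.hasMFDerivAt).mdifferentiableAt

/-- The pairing of `C^n` maps is `C^n`. [folklore] -/
theorem contMDiff_real_inner {n : ℕ∞ω} {ψ φ : M → S} (hψ : CMDiff n ψ) (hφ : CMDiff n φ) :
    CMDiff n (fun y ↦ ⟪ψ y, φ y⟫) :=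
  contDiff_inner.comp_contMDiff (hψ.prodMk_space hφ)

/-- **Chain rule through a fixed continuous linear map** (`HasMFDerivAt` form). [folklore] -/
theorem hasMFDerivAt_clm_apply_comp (L : S →L[ℝ] S') {φ : M → S} {x : M}
    {dφ : TangentSpace I x →L[ℝ] S} (hφ : HasMFDerivAt I 𝓘(ℝ, S) φ x dφ) :
    HasMFDerivAt I 𝓘(ℝ, S') (fun y ↦ L (φ y)) x (L.comp dφ) :=
  (hasMFDerivAt_iff_hasFDerivAt.2 (L.hasFDerivAt (x := φ x))).comp x hφ

/-- **Chain rule through a fixed continuous linear map**: `d(L ∘ φ)(v) = L(dφ(v))`. [folklore] -/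
theorem mvfderiv_clm_apply_comp (L : S →L[ℝ] S') {φ : M → S} {x : M} (hφ : MDiffAt φ x)
    (v : TangentSpace I x) :
    mvfderiv I (fun y ↦ L (φ y)) x v = L (mvfderiv I φ x v) := by
  have h := hasMFDerivAt_clm_apply_comp L hφ.hasMFDerivAt
  show mfderiv I 𝓘(ℝ, S') (fun y ↦ L (φ y)) x v = _
  rw [h.mfderiv]
  rfl

/-- `L ∘ φ` is differentiable. [folklore] -/
theorem mdifferentiableAt_clm_apply_comp (L : S →L[ℝ] S') {φ : M → S} {x : M}
    (hφ : MDiffAt φ x) : MDiffAt (fun y ↦ L (φ y)) x :=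
  (hasMFDerivAt_clm_apply_comp L hφ.hasMFDerivAt).mdifferentiableAt

/-- `L ∘ φ` is `C^n`. [folklore] -/
theorem contMDiff_clm_apply_comp {n : ℕ∞ω} (L : S →L[ℝ] S') {φ : M → S} (hφ : CMDiff n φ) :
    CMDiff n (fun y ↦ L (φ y)) :=
  L.contDiff.comp_contMDiff hφ

end Calculus

/-! ### Geometry: orthonormal frames on a data manifold -/

section Geometry

variable {X : Type*} [TopologicalSpace X] [ChartedSpace E3 X] [IsManifold (𝓡 3) ∞ X]
  (D : InitialDataSet (𝓡 3) X) [D.metric.HasLeviCivita]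
  {F : Fin 3 → Π x : X, TangentSpace (𝓡 3) x}

/-- **The connection coefficients of an orthonormal frame are antisymmetric**:
`h(∇ᵥFᵢ, Fⱼ) + h(Fᵢ, ∇ᵥFⱼ) = 0` (metric compatibility applied to the constant functions
`h(Fᵢ, Fⱼ) = δᵢⱼ`). O'Neill 1983, Ch. 3, Thm. 3.11 (D4). [cite: ONeill1983, Ch. 3, Thm. 3.11] -/
theorem val_leviCivita_frame_antisymm (hF : ∀ i x, MDifferentiableAt (𝓡 3) ((𝓡 3).prod 𝓘(ℝ, E3))
      (fun y ↦ (TotalSpace.mk' E3 y (F i y) : TangentBundle (𝓡 3) X)) x)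
    (horth : ∀ x i j, D.h.inner x (F i x) (F j x) = if i = j then 1 else 0) (x : X)
    (v : TangentSpace (𝓡 3) x) (i j : Fin 3) :
    D.metric.val x (D.metric.leviCivita (F i) x v) (F j x) =
      -D.metric.val x (D.metric.leviCivita (F j) x v) (F i x) := by
  have hcompat : D.metric.IsCompatible D.metric.leviCivita :=
    (PseudoRiemannianMetric.isLeviCivita_leviCivita_holds (g := D.metric)).2
  have hVd := FiberBundle.mdifferentiableAt_extend (I := 𝓡 3) (F := E3) v
  have h := hcompat hVd (hF i x) (hF j x)
  have hconst : (fun y ↦ D.metric.val y (F i y) (F j y)) =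
      fun _ ↦ (if i = j then (1 : ℝ) else 0) :=
    funext fun y ↦ horth y i j
  rw [hconst, mvfderiv_const, FiberBundle.extend_apply_self, zero_apply,
    D.metric.symm x (F i x)] at h
  linarith

/-- **Covariant derivative of a frame expansion, paired with the frame**: for differentiable
coefficients `cᵢ`, `h(∇ᵥ(Σ cᵢFᵢ), Fⱼ) = dcⱼ(v) + Σᵢ cᵢ h(∇ᵥFᵢ, Fⱼ)` (additivity and the
Leibniz rule of `∇`, orthonormality). O'Neill 1983, Ch. 3, Def. 3.8/Prop. 3.13.
[cite: ONeill1983, Ch. 3, Prop. 3.13] -/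
theorem val_leviCivita_frameSum (hF : ∀ i x, MDifferentiableAt (𝓡 3) ((𝓡 3).prod 𝓘(ℝ, E3))
      (fun y ↦ (TotalSpace.mk' E3 y (F i y) : TangentBundle (𝓡 3) X)) x)
    (horth : ∀ x i j, D.h.inner x (F i x) (F j x) = if i = j then 1 else 0)
    {c : Fin 3 → X → ℝ} {x : X} (hc : ∀ i, MDifferentiableAt (𝓡 3) 𝓘(ℝ, ℝ) (c i) x)
    (v : TangentSpace (𝓡 3) x)
    (j : Fin 3) :
    D.metric.val x (D.metric.leviCivita (fun y ↦ ∑ i, c i y • F i y) x v) (F j x) =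
      mvfderiv (𝓡 3) (c j) x v +
        ∑ i, c i x * D.metric.val x (D.metric.leviCivita (F i) x v) (F j x) := by
  have hcov := D.metric.leviCivita.isCovariantDerivativeOn (s := Set.univ)
  have hsum : (fun y ↦ ∑ i, c i y • F i y) = (c 0 • F 0 + c 1 • F 1) + c 2 • F 2 := by
    funext y
    simp only [Fin.sum_univ_three, Pi.add_apply, Pi.smul_apply']
  have hs : ∀ i, MDifferentiableAt (𝓡 3) ((𝓡 3).prod 𝓘(ℝ, E3))
      (fun y ↦ (TotalSpace.mk' E3 y ((c i • F i) y) : TangentBundle (𝓡 3) X)) x := fun i ↦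
    (hc i).smul_section (hF i x)
  have h01 : MDifferentiableAt (𝓡 3) ((𝓡 3).prod 𝓘(ℝ, E3))
      (fun y ↦ (TotalSpace.mk' E3 y ((c 0 • F 0 + c 1 • F 1) y) : TangentBundle (𝓡 3) X)) x :=
    mdifferentiableAt_add_section (hs 0) (hs 1)
  rw [hsum, hcov.add h01 (hs 2), hcov.add (hs 0) (hs 1), hcov.leibniz (hF 0 x) (hc 0),
    hcov.leibniz (hF 1 x) (hc 1), hcov.leibniz (hF 2 x) (hc 2)]
  have horth' : ∀ i j, D.metric.val x (F i x) (F j x) = if i = j then 1 else 0 :=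
    fun i j ↦ horth x i j
  simp only [add_apply, smul_apply,
    ContinuousLinearMap.smulRight_apply, map_add, map_smul, smul_eq_mul, horth',
    Fin.sum_univ_three]
  match j with
  | 0 => simp; ring
  | 1 => simp; ring
  | 2 => simp; ring

omit [D.metric.HasLeviCivita] in
/-- **An orthonormal triad is a basis**: two linear functionals on `T_xX` (`dim = 3`) that agree
on `F₁, F₂, F₃` agree (orthonormal vectors are linearly independent, and three of them span).
[folklore] -/
theorem clm_eq_of_frame {x : X}
    (horth : ∀ i j, D.h.inner x (F i x) (F j x) = if i = j then 1 else 0)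
    (ℓ₁ ℓ₂ : TangentSpace (𝓡 3) x →L[ℝ] ℝ) (h : ∀ j, ℓ₁ (F j x) = ℓ₂ (F j x)) : ℓ₁ = ℓ₂ := by
  have hli : LinearIndependent ℝ (fun i ↦ F i x) := by
    rw [Fintype.linearIndependent_iff]
    intro g hg i
    have h1 := congrArg (fun w ↦ D.h.inner x w (F i x)) hg
    simp only [map_sum, map_smul, _root_.sum_apply, smul_apply,
      smul_eq_mul, horth, map_zero, zero_apply] at h1
    simpa using h1
  have hspan : Submodule.span ℝ (Set.range fun i ↦ F i x) = ⊤ := by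
    refine hli.span_eq_top_of_card_eq_finrank ?_
    show Fintype.card (Fin 3) = Module.finrank ℝ E3
    rw [finrank_euclideanSpace_fin, Fintype.card_fin]
  exact ContinuousLinearMap.coe_inj.1 (LinearMap.ext_on_range hspan h)

end Geometry

/-! ### Main result: Sen–Witten-parallel pairs give Killing initial data -/

section Main

variable {X : Type*} [TopologicalSpace X] [ChartedSpace E3 X] [IsManifold (𝓡 3) ∞ X]
  (D : InitialDataSet (𝓡 3) X) [D.metric.HasLeviCivita]
  {S : Type*} [NormedAddCommGroup S] [InnerProductSpace ℝ S]

/-- **Sen–Witten-parallel spinor fields give translational Killing initial data.** Let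
`σ₁, σ₂, σ₃` be symmetric operators on a real inner product space `S` with the Clifford
relations `σᵢσⱼ + σⱼσᵢ = 2δᵢⱼ` (e.g. the Pauli matrices on `ℂ² ≅ ℝ⁴`), let `(F₁, F₂, F₃)` be a
smooth global `h`-orthonormal frame of the data manifold `(X, h, k)` with connection
coefficients `ω_{ij}(v) = h(∇ᵥFᵢ, Fⱼ)`, and let `ψ, φ : X → S` be differentiable spinor fields
(components in the spin frame induced by `F`) which are parallel for the Sen–Witten connection,
`dψ(v) = ¼ Σ ω_{ij}(v) σᵢσⱼψ − ½ Σ k(v, Fᵢ) σᵢψ` (Beig–Chruściel 1996, (A.10)). Then the pairing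
`N = ⟪ψ, φ⟫`, `Y = Σᵢ ⟪ψ, σᵢφ⟫ Fᵢ` (ibid., (A.11.0): `N = ψ†φ`, `Yᵢ = ψ†γ₀γᵢφ`) is a
translational Killing initial datum: the lapse equation `dN(v) = −k(v, Y)` and the shift
equation `h(∇ᵥY, w) = −N k(v, w)` hold (ibid., (A.11)). The proof is the algebra
`pairing_identities` (metric compatibility makes `Ω` antisymmetric) together with the Leibniz
rules for `⟪ψ, φ⟫` and `Σ cᵢFᵢ`. [cite: BeigChrusciel1996, App. A, (A.10)–(A.11.0)] -/
theorem kid_of_parallel (σ : Fin 3 → S →L[ℝ] S) (hsymm : ∀ i a b, ⟪σ i a, b⟫ = ⟪a, σ i b⟫)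
    (hcl : ∀ i j a, σ i (σ j a) + σ j (σ i a) = if i = j then (2 : ℝ) • a else 0)
    {F : Fin 3 → Π x : X, TangentSpace (𝓡 3) x}
    (hF : ∀ i x, MDifferentiableAt (𝓡 3) ((𝓡 3).prod 𝓘(ℝ, E3))
      (fun y ↦ (TotalSpace.mk' E3 y (F i y) : TangentBundle (𝓡 3) X)) x)
    (horth : ∀ x i j, D.h.inner x (F i x) (F j x) = if i = j then 1 else 0)
    (Ω : Fin 3 → Fin 3 → Π x : X, TangentSpace (𝓡 3) x → ℝ)
    (hω : ∀ i j x v, Ω i j x v = D.metric.val x (D.metric.leviCivita (F i) x v) (F j x))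
    {ψ φ : X → S} (hψd : MDifferentiable (𝓡 3) 𝓘(ℝ, S) ψ)
    (hφd : MDifferentiable (𝓡 3) 𝓘(ℝ, S) φ)
    (hψ : ∀ (x : X) (v : TangentSpace (𝓡 3) x), mvfderiv (𝓡 3) ψ x v =
      (1 / 4 : ℝ) • (∑ i, ∑ j, Ω i j x v • σ i (σ j (ψ x))) -
        (1 / 2 : ℝ) • ∑ i, D.k x v (F i x) • σ i (ψ x))
    (hφ : ∀ (x : X) (v : TangentSpace (𝓡 3) x), mvfderiv (𝓡 3) φ x v =
      (1 / 4 : ℝ) • (∑ i, ∑ j, Ω i j x v • σ i (σ j (φ x))) -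
        (1 / 2 : ℝ) • ∑ i, D.k x v (F i x) • σ i (φ x))
    {N : X → ℝ} (hN : ∀ x, N x = ⟪ψ x, φ x⟫)
    {Y : Π x : X, TangentSpace (𝓡 3) x} (hY : ∀ x, Y x = ∑ i, ⟪ψ x, σ i (φ x)⟫ • F i x) :
    (∀ (x : X) (v : TangentSpace (𝓡 3) x), mvfderiv (𝓡 3) N x v = -(D.k x v (Y x))) ∧
      ∀ (x : X) (v w : TangentSpace (𝓡 3) x),
        D.metric.val x (D.metric.leviCivita Y x v) w = -(N x * D.k x v w) := by
  have hNf : N = fun y ↦ ⟪ψ y, φ y⟫ := funext hN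
  have hYf : Y = fun y ↦ ∑ i, (fun i y ↦ ⟪ψ y, σ i (φ y)⟫) i y • F i y := funext hY
  -- the pointwise algebra at `(x, v)`
  have halg : ∀ (x : X) (v : TangentSpace (𝓡 3) x),
      (⟪mvfderiv (𝓡 3) ψ x v, φ x⟫ + ⟪ψ x, mvfderiv (𝓡 3) φ x v⟫ =
          -∑ i, D.k x v (F i x) * ⟪ψ x, σ i (φ x)⟫) ∧
        ∀ j, ⟪mvfderiv (𝓡 3) ψ x v, σ j (φ x)⟫ + ⟪ψ x, σ j (mvfderiv (𝓡 3) φ x v)⟫ =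
          -(∑ i, Ω i j x v * ⟪ψ x, σ i (φ x)⟫) - D.k x v (F j x) * ⟪ψ x, φ x⟫ := by
    intro x v
    set P : S → S := fun a ↦ (1 / 4 : ℝ) • (∑ i, ∑ j, Ω i j x v • σ i (σ j a)) -
      (1 / 2 : ℝ) • ∑ i, D.k x v (F i x) • σ i a with hP
    have hωa : ∀ i j, Ω i j x v = -Ω j i x v := fun i j ↦ by
      rw [hω, hω]
      exact val_leviCivita_frame_antisymm D hF horth x v i j
    have h := pairing_identities σ hsymm hcl (fun i j ↦ Ω i j x v) hωa (fun i ↦ D.k x v (F i x))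
      (ψ x) (φ x) P (fun a ↦ rfl)
    rw [hψ x v, hφ x v]
    exact h
  -- `k(v, Y) = Σ k(v, Fᵢ) Yⁱ`
  have hkY : ∀ (x : X) (v : TangentSpace (𝓡 3) x),
      D.k x v (Y x) = ∑ i, D.k x v (F i x) * ⟪ψ x, σ i (φ x)⟫ := fun x v ↦ by
    rw [hY x, map_sum]
    exact Finset.sum_congr rfl fun i _ ↦ by rw [map_smul, smul_eq_mul, mul_comm]
  refine ⟨fun x v ↦ ?_, fun x v w ↦ ?_⟩
  · -- the lapse equation
    rw [hNf, mvfderiv_real_inner (hψd x) (hφd x), (halg x v).1, hkY]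
  · -- the shift equation, first against the frame
    have hc : ∀ i, MDifferentiableAt (𝓡 3) 𝓘(ℝ, ℝ) (fun y ↦ ⟪ψ y, σ i (φ y)⟫) x := fun i ↦
      mdifferentiableAt_real_inner (hψd x) (mdifferentiableAt_clm_apply_comp (σ i) (hφd x))
    have hframe : ∀ j, D.metric.val x (D.metric.leviCivita Y x v) (F j x) =
        -(N x * D.k x v (F j x)) := by
      intro j
      rw [hYf, val_leviCivita_frameSum D hF horth hc v j,
        mvfderiv_real_inner (hψd x) (mdifferentiableAt_clm_apply_comp (σ j) (hφd x)),
        mvfderiv_clm_apply_comp (σ j) (hφd x), (halg x v).2 j, hN x]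
      simp only [← hω]
      rw [show ∑ i, ⟪ψ x, σ i (φ x)⟫ * Ω i j x v = ∑ i, Ω i j x v * ⟪ψ x, σ i (φ x)⟫ from
        Finset.sum_congr rfl fun i _ ↦ mul_comm _ _]
      ring
    -- then against every `w`
    have heq := clm_eq_of_frame D (horth x) (D.metric.val x (D.metric.leviCivita Y x v))
      (-(N x) • D.k x v) fun j ↦ by
        rw [hframe j, smul_apply, smul_eq_mul, neg_mul]
    have := DFunLike.congr_fun heq w
    rw [this, smul_apply, smul_eq_mul, neg_mul]

omit [IsManifold (𝓡 3) ∞ X] in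
/-- **The pairing lapse is smooth**: `y ↦ ⟪ψ y, φ y⟫` is `C^n` for `C^n` spinor fields.
[folklore] -/
theorem contMDiff_pairingLapse {n : ℕ∞ω} (_σ : Fin 3 → S →L[ℝ] S) {ψ φ : X → S}
    (hψ : ContMDiff (𝓡 3) 𝓘(ℝ, S) n ψ) (hφ : ContMDiff (𝓡 3) 𝓘(ℝ, S) n φ) :
    ContMDiff (𝓡 3) 𝓘(ℝ, ℝ) n (fun y ↦ ⟪ψ y, φ y⟫) :=
  contMDiff_real_inner hψ hφ

omit [D.metric.HasLeviCivita] in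
/-- **The pairing shift is a smooth vector field**: `y ↦ Σᵢ ⟪ψ y, σᵢ φ y⟫ Fᵢ(y)` is a `C^n`
section of `TX` for `C^n` spinor fields and a `C^n` frame. [folklore] -/
theorem contMDiff_pairingShift {n : ℕ∞ω} (_D : InitialDataSet (𝓡 3) X) (σ : Fin 3 → S →L[ℝ] S)
    {F : Fin 3 → Π x : X, TangentSpace (𝓡 3) x}
    (hF : ∀ i, ContMDiff (𝓡 3) ((𝓡 3).prod 𝓘(ℝ, E3)) n
      fun y ↦ (TotalSpace.mk' E3 y (F i y) : TangentBundle (𝓡 3) X))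
    {ψ φ : X → S} (hψ : ContMDiff (𝓡 3) 𝓘(ℝ, S) n ψ) (hφ : ContMDiff (𝓡 3) 𝓘(ℝ, S) n φ) :
    ContMDiff (𝓡 3) ((𝓡 3).prod 𝓘(ℝ, E3)) n
      fun y ↦ (TotalSpace.mk' E3 y (∑ i, ⟪ψ y, σ i (φ y)⟫ • F i y) : TangentBundle (𝓡 3) X) :=
  ContMDiff.sum_section fun i _ ↦
    (contMDiff_real_inner hψ (contMDiff_clm_apply_comp (σ i) hφ)).smul_section (hF i)

omit [D.metric.HasLeviCivita] in
/-- **Parallel spinor fields are stable under operators commuting with the `σᵢ`** (e.g. the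
complex structure `J = i` of `ℂ²`, which turns one Sen–Witten-parallel spinor into a second,
linearly independent one): if `L σᵢ = σᵢ L` and `ψ` is parallel, so is `L ∘ ψ`. [folklore] -/
theorem parallel_clm_comp (σ : Fin 3 → S →L[ℝ] S) (L : S →L[ℝ] S)
    (hL : ∀ i a, L (σ i a) = σ i (L a)) {F : Fin 3 → Π x : X, TangentSpace (𝓡 3) x}
    (Ω : Fin 3 → Fin 3 → Π x : X, TangentSpace (𝓡 3) x → ℝ) {ψ : X → S}
    (hψd : MDifferentiable (𝓡 3) 𝓘(ℝ, S) ψ)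
    (hψ : ∀ (x : X) (v : TangentSpace (𝓡 3) x), mvfderiv (𝓡 3) ψ x v =
      (1 / 4 : ℝ) • (∑ i, ∑ j, Ω i j x v • σ i (σ j (ψ x))) -
        (1 / 2 : ℝ) • ∑ i, D.k x v (F i x) • σ i (ψ x))
    (x : X) (v : TangentSpace (𝓡 3) x) :
    mvfderiv (𝓡 3) (fun y ↦ L (ψ y)) x v =
      (1 / 4 : ℝ) • (∑ i, ∑ j, Ω i j x v • σ i (σ j (L (ψ x)))) -
        (1 / 2 : ℝ) • ∑ i, D.k x v (F i x) • σ i (L (ψ x)) := by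
  rw [mvfderiv_clm_apply_comp L (hψd x), hψ x v]
  simp only [map_sub, map_smul, map_sum, hL]

end Main

end SenParallel

end Literature.Geometry.Lorentzian

end
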